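import Summits.QuantumFields.YangMills.Theorems.BalabanLadderNTReferenceTorusCollarPackage
import HarnessLib

/-!
# Crux `NT` (stmt-QuantumFields-19353): `BalabanLadder.NT` BY NAME from the periodic reference package with the exterior
# ceilings assumed only at lattice depth `≥ d₀` — ANY fixed `d₀` (re-cut option «v4T_{d₀}», e.g. `d₀ = 2`)

Helper file (`--supports stmt-QuantumFields-19353`) of the fleet lead prover of crux `NT` (unit `ym-spine-19353-p1`, GEN 13).
Hypothesis-free composition (one filter step) over g4's `Reference.lowerBounds_of_torusReferencePackage_collar`.

WHY.  The registered skeleton v4T (4297522f58b4c3a5) states clauses 1–3 (E1/E2/E3-osc) at `1 ≤ depth`; GEN 13's corner price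
(`…NTCornerPrice`: the unit cube `b = 1` is admitted, so `C₁ ≥ 6(N − Re tr ρ(g))`, e.g. `C₁ ≥ 24` at the fundamental `SU(2)`)
is an artefact of that typing — v1's `FBL` was stated at `2 ≤ depth` precisely so that no plaquette of a constrained site is frozen.
Since the transfer only uses the ceilings at physical depth `κ` (lattice depth `κ/a(β) → ∞`), ANY fixed minimal depth `d₀` suffices:

* **`nt_of_torusReferencePackage_minDepth d₀`** — the hypothesis of `Reference.nt_of_torusReferencePackage` (= the body of `RefPkgT`)
  with `1 ≤ depth` replaced by `d₀ ≤ depth` in clauses 1–3 (clause 2: both sites, clause 3: all three) gives `BalabanLadder.NT` BY NAME.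
  `d₀ = 1` is the registered composition again; `d₀ = 2` («v4T₂») escapes the corner price while KEEPING GEN 12's cap-based prices
  (`floor₂_le_of_e1osc`, `timeGap_le_collar`, `C₂_le_of_clause4`, … use clause 1 only at cube centres of depth `R + 2 ≥ 3`).

Located remark for the owner (zero ask): v4T₂ is the minimal textual change that removes the lattice-corner constant from the engine
bill; the collar form (`nt_of_torusReferencePackage_collar`, depth `≥ κ/aβ`) removes boundary layers altogether.

HONEST FRAMING.  Plumbing; nothing about the truth of any clause; not a floor, not AF, not NT, not the seam, not the gap; not Clay.
-/

set_option autoImplicit false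

noncomputable section

open scoped SchwartzMap
open MeasureTheory Filter Topology
open Literature.MathematicalPhysics.QuantumFieldTheory Literature.MathematicalPhysics.QuantumLattice
open Literature.Probability.LatticeModels
open Summit.QuantumFields.YangMills.Cruxes.OSLegsFromFemtoAndGap.DlrCollarTransfer

namespace Summit.QuantumFields.YangMills.Cruxes.NT.Reference

/-- Along a unit map `a → 0`, a physical collar `κ > 0` eventually exceeds any fixed lattice depth: `d₀ ≤ κ / a β`. [folklore] -/
theorem eventually_natCast_le_div {a : ℝ → ℝ} (ha₀ : ∀ β, 0 < a β) (ha : Tendsto a atTop (𝓝 0)) {κ : ℝ} (hκ : 0 < κ)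
    (d₀ : ℕ) : ∀ᶠ β in atTop, (d₀ : ℝ) ≤ κ / a β := by
  have hpos : 0 < κ / ((d₀ : ℝ) + 1) := by positivity
  filter_upwards [ha.eventually (Iic_mem_nhds hpos)] with β hβ
  have hβ' : a β ≤ κ / ((d₀ : ℝ) + 1) := hβ
  rw [le_div_iff₀ (ha₀ β)]
  rw [le_div_iff₀ (by positivity)] at hβ'
  nlinarith [ha₀ β]

section MinDepth

variable (G : Type) [Group G] [TopologicalSpace G] [IsTopologicalGroup G] [CompactSpace G]
  [MeasurableSpace G] [BorelSpace G] (r : LatticeRep G)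

/-- A ceiling assumed at lattice depth `≥ d₀` holds at depth `≥ κ/aβ` once `d₀ ≤ κ/aβ`. [folklore] -/
theorem minDepth_of_collarDepth {d₀ : ℕ} {κ s : ℝ} (hd : (d₀ : ℝ) ≤ κ / s) {c : Fin 4 → ℤ} {b : ℕ} {x : Fin 4 → ℤ}
    (hx : κ / s ≤ (depth c b x : ℝ)) : d₀ ≤ depth c b x := by
  exact_mod_cast hd.trans hx

/-- **`LowerBounds` from the periodic reference package with ceilings at lattice depth `≥ d₀`** (any fixed `d₀ : ℕ`). [folklore] -/
theorem lowerBounds_of_torusReferencePackage_minDepth (d₀ : ℕ) (a : ℝ → ℝ) (ha₀ : ∀ β, 0 < a β)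
    (ha : Tendsto a atTop (𝓝 0)) {C₁ C₂ C₃ ℓ σ κ : ℝ} (hC₁ : 0 ≤ C₁) (hC₂ : 0 ≤ C₂) (hC₃ : 0 ≤ C₃) (hσ : 0 < σ)
    (hκ : 0 < κ) (hℓ : 2 * (σ + κ) < ℓ)
    (hE1 : ∃ β₁ : ℝ, ∀ β : ℝ, β₁ ≤ β → ∀ (c : Fin 4 → ℤ) (b : ℕ), (b : ℝ) * a β ≤ ℓ →
      ∀ (η η' : LGConfig 4 G) (x : Fin 4 → ℤ), d₀ ≤ depth c b x →
        |kerE G r β c b η (dens G r x) - kerE G r β c b η' (dens G r x)| ≤ C₁ / (depth c b x : ℝ) ^ 4)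
    (hE2 : ∃ β₂ : ℝ, ∀ β : ℝ, β₂ ≤ β → ∀ (c : Fin 4 → ℤ) (b : ℕ), (b : ℝ) * a β ≤ ℓ →
      ∀ (η η' : LGConfig 4 G) (x y : Fin 4 → ℤ), d₀ ≤ depth c b x → d₀ ≤ depth c b y →
        |kerCov G r β c b η (dens G r x) (dens G r y) - kerCov G r β c b η' (dens G r x) (dens G r y)| ≤
          C₂ / ((min (depth c b x) (depth c b y) : ℕ) : ℝ) ^ 4 / (1 + ‖siteToE (y - x)‖) ^ 4)
    (hE3 : ∃ β₃ : ℝ, ∀ β : ℝ, β₃ ≤ β → ∀ (c : Fin 4 → ℤ) (b : ℕ), (b : ℝ) * a β ≤ ℓ →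
      ∀ (η η' : LGConfig 4 G) (x y z : Fin 4 → ℤ), d₀ ≤ depth c b x → d₀ ≤ depth c b y → d₀ ≤ depth c b z →
        |kerK3 G r β c b η x y z - kerK3 G r β c b η' x y z| ≤
          C₃ / ((min (min (depth c b x) (depth c b y)) (depth c b z) : ℕ) : ℝ) ^ 4 /
            (1 + min (min ‖siteToE (y - x)‖ ‖siteToE (z - y)‖) ‖siteToE (z - x)‖) ^ 8)
    (hR2 : ∃ (v : 𝓢(EuclideanSpace ℝ (Fin 4), ℝ)) (ε β₅ : ℝ) (L₀ : ℝ → ℕ),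
      tsupport (v : EuclideanSpace ℝ (Fin 4) → ℝ) ⊆ {y | 0 < y 0} ∧
      tsupport (v : EuclideanSpace ℝ (Fin 4) → ℝ) ⊆ Metric.closedBall 0 σ ∧ 0 < ε ∧
      ∀ β : ℝ, β₅ ≤ β → σ + κ + 1 ≤ a β * L₀ β ∧
        ε + 2 * (C₁ * (a β / κ) ^ 4 * ∑ x ∈ box 4 (L₀ β), |thetaTest 4 v (a β • siteToE x)|) *
              (C₁ * (a β / κ) ^ 4 * ∑ y ∈ box 4 (L₀ β), |v (a β • siteToE y)|) +
            C₂ * (a β / κ) ^ 4 * ∑ x ∈ box 4 (L₀ β), ∑ y ∈ box 4 (L₀ β),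
              |thetaTest 4 v (a β • siteToE x)| * |v (a β • siteToE y)| / (1 + ‖siteToE (y - x)‖) ^ 4 ≤
          Q2 G r β (L₀ β) (a β) (thetaTest 4 v) v)
    (hR3 : ∃ (f g h : 𝓢(EuclideanSpace ℝ (Fin 4), ℝ)) (ε β₅ : ℝ) (L₀ : ℝ → ℕ),
      Disjoint (tsupport (f : EuclideanSpace ℝ (Fin 4) → ℝ)) (tsupport (g : EuclideanSpace ℝ (Fin 4) → ℝ)) ∧
      Disjoint (tsupport (g : EuclideanSpace ℝ (Fin 4) → ℝ)) (tsupport (h : EuclideanSpace ℝ (Fin 4) → ℝ)) ∧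
      Disjoint (tsupport (f : EuclideanSpace ℝ (Fin 4) → ℝ)) (tsupport (h : EuclideanSpace ℝ (Fin 4) → ℝ)) ∧
      tsupport (f : EuclideanSpace ℝ (Fin 4) → ℝ) ⊆ Metric.closedBall 0 σ ∧
      tsupport (g : EuclideanSpace ℝ (Fin 4) → ℝ) ⊆ Metric.closedBall 0 σ ∧
      tsupport (h : EuclideanSpace ℝ (Fin 4) → ℝ) ⊆ Metric.closedBall 0 σ ∧ 0 < ε ∧
      ∀ β : ℝ, β₅ ≤ β → σ + κ + 1 ≤ a β * L₀ β ∧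
        ε + ∑ x ∈ box 4 (L₀ β), ∑ y ∈ box 4 (L₀ β), ∑ z ∈ box 4 (L₀ β),
            |f (a β • siteToE x)| * |g (a β • siteToE y)| * |h (a β • siteToE z)| *
              (2 * ((C₁ * (a β / κ) ^ 4) * (C₂ * (a β / κ) ^ 4 / (1 + ‖siteToE (z - y)‖) ^ 4) +
                    (C₁ * (a β / κ) ^ 4) * (C₂ * (a β / κ) ^ 4 / (1 + ‖siteToE (z - x)‖) ^ 4) +
                    (C₁ * (a β / κ) ^ 4) * (C₂ * (a β / κ) ^ 4 / (1 + ‖siteToE (y - x)‖) ^ 4) +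
                    (C₁ * (a β / κ) ^ 4) * (C₁ * (a β / κ) ^ 4) * (C₁ * (a β / κ) ^ 4)) +
                C₃ * (a β / κ) ^ 4 /
                  (1 + min (min ‖siteToE (y - x)‖ ‖siteToE (z - y)‖) ‖siteToE (z - x)‖) ^ 8) ≤
          |Q3 G r β (L₀ β) (a β) f g h|) :
    LowerBounds G r a := by
  obtain ⟨βκ, hβκ⟩ := eventually_atTop.1 (eventually_natCast_le_div ha₀ ha hκ d₀)
  obtain ⟨β₁, H1⟩ := hE1
  obtain ⟨β₂, H2⟩ := hE2
  obtain ⟨β₃, H3⟩ := hE3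
  refine lowerBounds_of_torusReferencePackage_collar G r a ha₀ ha hC₁ hC₂ hC₃ hσ hκ hℓ ?_ ?_ ?_ hR2 hR3
  · refine ⟨max β₁ βκ, fun β hβ c b hb η η' x hx => ?_⟩
    exact H1 β (le_trans (le_max_left _ _) hβ) c b hb η η' x
      (minDepth_of_collarDepth (hβκ β (le_trans (le_max_right _ _) hβ)) hx)
  · refine ⟨max β₂ βκ, fun β hβ c b hb η η' x y hx hy => ?_⟩
    have hd := hβκ β (le_trans (le_max_right _ _) hβ)
    exact H2 β (le_trans (le_max_left _ _) hβ) c b hb η η' x y (minDepth_of_collarDepth hd hx)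
      (minDepth_of_collarDepth hd hy)
  · refine ⟨max β₃ βκ, fun β hβ c b hb η η' x y z hx hy hz => ?_⟩
    have hd := hβκ β (le_trans (le_max_right _ _) hβ)
    exact H3 β (le_trans (le_max_left _ _) hβ) c b hb η η' x y z (minDepth_of_collarDepth hd hx)
      (minDepth_of_collarDepth hd hy) (minDepth_of_collarDepth hd hz)

end MinDepth

/-- **The crux `BalabanLadder.NT` BY NAME from the periodic reference package with the three exterior-oscillation ceilings
assumed only at lattice depth `≥ d₀`** — any fixed `d₀ : ℕ`; `d₀ = 1` is the registered composition
(`nt_of_torusReferencePackage`, skeleton v4T), `d₀ = 2` the corner-free re-cut «v4T₂». [folklore] -/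
theorem nt_of_torusReferencePackage_minDepth (d₀ : ℕ)
    (h : ∀ (G : Type) [Group G] [TopologicalSpace G] [IsTopologicalGroup G] [CompactSpace G],
      IsCompactSimpleLieGroup G → letI : MeasurableSpace G := borel G; haveI : BorelSpace G := ⟨rfl⟩;
      ∃ (r : LatticeRep G) (a : ℝ → ℝ), (∀ β, 0 < a β) ∧ Tendsto a atTop (𝓝 0) ∧
      ∃ (C₁ C₂ C₃ ℓ σ κ : ℝ), 0 ≤ C₁ ∧ 0 ≤ C₂ ∧ 0 ≤ C₃ ∧ 0 < σ ∧ 0 < κ ∧ 2 * (σ + κ) < ℓ ∧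
      (∃ β₁ : ℝ, ∀ β : ℝ, β₁ ≤ β → ∀ (c : Fin 4 → ℤ) (b : ℕ), (b : ℝ) * a β ≤ ℓ →
        ∀ (η η' : LGConfig 4 G) (x : Fin 4 → ℤ), d₀ ≤ depth c b x →
          |kerE G r β c b η (dens G r x) - kerE G r β c b η' (dens G r x)| ≤ C₁ / (depth c b x : ℝ) ^ 4) ∧
      (∃ β₂ : ℝ, ∀ β : ℝ, β₂ ≤ β → ∀ (c : Fin 4 → ℤ) (b : ℕ), (b : ℝ) * a β ≤ ℓ →
        ∀ (η η' : LGConfig 4 G) (x y : Fin 4 → ℤ), d₀ ≤ depth c b x → d₀ ≤ depth c b y →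
          |kerCov G r β c b η (dens G r x) (dens G r y) - kerCov G r β c b η' (dens G r x) (dens G r y)| ≤
            C₂ / ((min (depth c b x) (depth c b y) : ℕ) : ℝ) ^ 4 / (1 + ‖siteToE (y - x)‖) ^ 4) ∧
      (∃ β₃ : ℝ, ∀ β : ℝ, β₃ ≤ β → ∀ (c : Fin 4 → ℤ) (b : ℕ), (b : ℝ) * a β ≤ ℓ →
        ∀ (η η' : LGConfig 4 G) (x y z : Fin 4 → ℤ), d₀ ≤ depth c b x → d₀ ≤ depth c b y → d₀ ≤ depth c b z →
          |kerK3 G r β c b η x y z - kerK3 G r β c b η' x y z| ≤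
            C₃ / ((min (min (depth c b x) (depth c b y)) (depth c b z) : ℕ) : ℝ) ^ 4 /
              (1 + min (min ‖siteToE (y - x)‖ ‖siteToE (z - y)‖) ‖siteToE (z - x)‖) ^ 8) ∧
      (∃ (v : 𝓢(EuclideanSpace ℝ (Fin 4), ℝ)) (ε β₅ : ℝ) (L₀ : ℝ → ℕ),
        tsupport (v : EuclideanSpace ℝ (Fin 4) → ℝ) ⊆ {y | 0 < y 0} ∧
        tsupport (v : EuclideanSpace ℝ (Fin 4) → ℝ) ⊆ Metric.closedBall 0 σ ∧ 0 < ε ∧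
        ∀ β : ℝ, β₅ ≤ β → σ + κ + 1 ≤ a β * L₀ β ∧
          ε + 2 * (C₁ * (a β / κ) ^ 4 * ∑ x ∈ box 4 (L₀ β), |thetaTest 4 v (a β • siteToE x)|) *
                (C₁ * (a β / κ) ^ 4 * ∑ y ∈ box 4 (L₀ β), |v (a β • siteToE y)|) +
              C₂ * (a β / κ) ^ 4 * ∑ x ∈ box 4 (L₀ β), ∑ y ∈ box 4 (L₀ β),
                |thetaTest 4 v (a β • siteToE x)| * |v (a β • siteToE y)| / (1 + ‖siteToE (y - x)‖) ^ 4 ≤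
            Q2 G r β (L₀ β) (a β) (thetaTest 4 v) v) ∧
      (∃ (f g h : 𝓢(EuclideanSpace ℝ (Fin 4), ℝ)) (ε β₅ : ℝ) (L₀ : ℝ → ℕ),
        Disjoint (tsupport (f : EuclideanSpace ℝ (Fin 4) → ℝ)) (tsupport (g : EuclideanSpace ℝ (Fin 4) → ℝ)) ∧
        Disjoint (tsupport (g : EuclideanSpace ℝ (Fin 4) → ℝ)) (tsupport (h : EuclideanSpace ℝ (Fin 4) → ℝ)) ∧
        Disjoint (tsupport (f : EuclideanSpace ℝ (Fin 4) → ℝ)) (tsupport (h : EuclideanSpace ℝ (Fin 4) → ℝ)) ∧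
        tsupport (f : EuclideanSpace ℝ (Fin 4) → ℝ) ⊆ Metric.closedBall 0 σ ∧
        tsupport (g : EuclideanSpace ℝ (Fin 4) → ℝ) ⊆ Metric.closedBall 0 σ ∧
        tsupport (h : EuclideanSpace ℝ (Fin 4) → ℝ) ⊆ Metric.closedBall 0 σ ∧ 0 < ε ∧
        ∀ β : ℝ, β₅ ≤ β → σ + κ + 1 ≤ a β * L₀ β ∧
          ε + ∑ x ∈ box 4 (L₀ β), ∑ y ∈ box 4 (L₀ β), ∑ z ∈ box 4 (L₀ β),
              |f (a β • siteToE x)| * |g (a β • siteToE y)| * |h (a β • siteToE z)| *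
                (2 * ((C₁ * (a β / κ) ^ 4) * (C₂ * (a β / κ) ^ 4 / (1 + ‖siteToE (z - y)‖) ^ 4) +
                      (C₁ * (a β / κ) ^ 4) * (C₂ * (a β / κ) ^ 4 / (1 + ‖siteToE (z - x)‖) ^ 4) +
                      (C₁ * (a β / κ) ^ 4) * (C₂ * (a β / κ) ^ 4 / (1 + ‖siteToE (y - x)‖) ^ 4) +
                      (C₁ * (a β / κ) ^ 4) * (C₁ * (a β / κ) ^ 4) * (C₁ * (a β / κ) ^ 4)) +
                  C₃ * (a β / κ) ^ 4 /
                    (1 + min (min ‖siteToE (y - x)‖ ‖siteToE (z - y)‖) ‖siteToE (z - x)‖) ^ 8) ≤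
            |Q3 G r β (L₀ β) (a β) f g h|)) :
    Summit.QuantumFields.YangMills.Theses.BalabanLadder.NT := by
  intro G _ _ _ _ hG
  letI : MeasurableSpace G := borel G
  haveI : BorelSpace G := ⟨rfl⟩
  obtain ⟨r, a, ha₀, ha, C₁, C₂, C₃, ℓ, σ, κ, hC₁, hC₂, hC₃, hσ, hκ, hℓ, hE1, hE2, hE3, hR2, hR3⟩ := h G hG
  exact ⟨r, a, ha₀, ha,
    lowerBounds_of_torusReferencePackage_minDepth G r d₀ a ha₀ ha hC₁ hC₂ hC₃ hσ hκ hℓ hE1 hE2 hE3 hR2 hR3⟩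

end Summit.QuantumFields.YangMills.Cruxes.NT.Reference

end
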